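import Summits.RiemannHypothesis.RiemannHypothesis.Theses.WeilComb
import Summits.RiemannHypothesis.RiemannHypothesis.Theorems.WeilCombCombSubcriticalStubAutocorrelation
import Literature.NumberTheory.LFunctions.WeilExplicit
import Literature.NumberTheory.LFunctions.WeilExplicitContinuous
import Literature.NumberTheory.LFunctions.WeilArchimedeanMoments
import Literature.NumberTheory.LFunctions.WeilArchimedeanPositivityProofs
import Literature.NumberTheory.LFunctions.WeilMellinBounds
import Literature.NumberTheory.LFunctions.WeilWindowSimpleEven
import Literature.NumberTheory.LFunctions.WeilGroundEnergyProofs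

/-!
# Exact prime term of the comb autocorrelation on the WHOLE exact-Helson window `2ε(M+1) ≤ 1`
(crux `WeilComb.CombShapePositivity`, item stmt-RiemannHypothesis-11229, line `Sketch`; first piece of the
exact-window bookkeeping for Theorem B = `2ε(M+1) ≤ 1 ⇒ 0 ≤ Re Q(comb)`, the unconditional milestone the
route (rev 8) asks every line on this crux to carry as a stub)

Let `φ` be a Weil test function with `tsupport φ ⊆ [-1, 1]`, `ε > 0`, `φ_ε = ε⁻¹ φ(·/ε)`,
`ψ_ε = φ_ε ⋆ φ̃_ε` and `g(x) = Σ_{m ≤ M} a_m φ_ε(x − log m)` a log-integer comb with `M ≥ 1` and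
`2 ε (M + 1) ≤ 1`.  Then the prime term of `k = g ⋆ g̃` is EXACTLY the von Mangoldt Helson form:

`Σ_n Λ(n) n^{-1/2} (k(log n) + k(−log n)) = ε⁻¹ ‖φ‖₂² · 2 Re Σ_{m ≤ M} Σ_{n ≤ M/m} Λ(n) n^{-1/2} a(nm) conj a(m)`.

This is `WeilCombSubcritical.stub_prime` (line `helson-dirichlet-slack` of the sibling crux `CombSubcritical`,
stated there under `8εM ≤ 1`) pushed to the sharp window `2ε(M+1) ≤ 1`, which is the whole regime where the
argument works: distinct positive integers `p ≠ q` with `min(p, q) ≤ M` satisfy the STRICT Diophantine gap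
`|log p − log q| ≥ log(1 + 1/min(p,q)) > 1/(min(p,q) + 1) ≥ 1/(M+1) ≥ 2ε`, so `ψ_ε(log p − log q) = 0`
(`tsupport ψ_ε ⊆ [−2ε, 2ε]`), and in `k(± log n)` only the terms `m = n m'` survive.  The proof is the
sibling file's, with the strict gap `1/(p+1) < log(1 + 1/p)` (from `x + 1 < exp x`, `x ≠ 0`) replacing the slack
factor `8`; the comb autocorrelation `k = Σ a_m conj a_{m'} τ_{log m − log m'} ψ_ε` is the landed
`WeilCombSubcritical.stub_autocorrelation`.
-/

noncomputable section

-- the sub-problem path RiemannHypothesis/RiemannHypothesis duplicates a namespace (D-0017)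
set_option linter.dupNamespace false

open scoped BigOperators ComplexConjugate
open Complex MeasureTheory Set

namespace Summit.RiemannHypothesis.RiemannHypothesis.Theorems.WeilCombBohrFejer

open Literature.NumberTheory.LFunctions

/-! ### Private toolkit: the dilate `φ_ε` and the kernel `ψ_ε = φ_ε ⋆ φ̃_ε` -/

/-- `φ_ε` is a Weil test function (`ε ≠ 0`). -/
private theorem isWeilTest_dil_window {φ : ℝ → ℂ} {ε : ℝ} (hφ : IsWeilTest φ) (hε : ε ≠ 0) :
    IsWeilTest (fun t : ℝ => (ε : ℂ)⁻¹ * φ (t / ε)) := by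
  have h1 : IsWeilTest (fun t : ℝ => φ (t / ε)) := by
    refine ⟨hφ.1.comp (contDiff_id.div_const ε), ?_⟩
    have e : (fun t : ℝ => φ (t / ε)) = φ ∘ (Homeomorph.mulRight₀ ε⁻¹ (inv_ne_zero hε)) := by
      ext t
      simp [div_eq_mul_inv]
    rw [e]
    exact hφ.2.comp_homeomorph _
  exact h1.const_mul _

/-- `tsupport φ ⊆ [-1, 1]` gives `tsupport φ_ε ⊆ [-ε, ε]` (`ε > 0`). -/
private theorem tsupport_dil_subset_window {φ : ℝ → ℂ} {ε : ℝ} (hsupp : tsupport φ ⊆ Icc (-1) 1)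
    (hε : 0 < ε) : tsupport (fun t : ℝ => (ε : ℂ)⁻¹ * φ (t / ε)) ⊆ Icc (-ε) ε := by
  refine closure_minimal ?_ isClosed_Icc
  intro t ht
  rw [Function.mem_support] at ht
  have hφ : φ (t / ε) ≠ 0 := fun h => ht (by simp [h])
  have hmem : t / ε ∈ Icc (-1 : ℝ) 1 := hsupp (subset_tsupport _ hφ)
  constructor
  · have h := hmem.1
    rw [le_div_iff₀ hε] at h
    linarith
  · have h := hmem.2
    rw [div_le_iff₀ hε] at h
    linarith

/-- `ψ_ε(s) = 0` for `|s| > 2ε`. -/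
private theorem psi_eq_zero_window {φ : ℝ → ℂ} {ε : ℝ} (hφ : IsWeilTest φ)
    (hsupp : tsupport φ ⊆ Icc (-1) 1) (hε : 0 < ε) {s : ℝ} (hs : 2 * ε < |s|) :
    weilConv (fun t : ℝ => (ε : ℂ)⁻¹ * φ (t / ε))
        (weilReflect (fun t : ℝ => (ε : ℂ)⁻¹ * φ (t / ε))) s = 0 := by
  have hsub : tsupport (weilConv (fun t : ℝ => (ε : ℂ)⁻¹ * φ (t / ε))
      (weilReflect (fun t : ℝ => (ε : ℂ)⁻¹ * φ (t / ε)))) ⊆ Icc (-(2 * ε)) (2 * ε) :=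
    tsupport_weilConv_weilReflect_subset (isWeilTest_dil_window hφ hε.ne').2
      (tsupport_dil_subset_window hsupp hε)
  refine eq_zero_of_tsupport_subset hsub fun h => ?_
  have h1 := h.1
  have h2 := h.2
  have : |s| ≤ 2 * ε := abs_le.2 ⟨h1, h2⟩
  linarith

/-- `ψ_ε(0) = ‖φ_ε‖₂² = ε⁻¹ ‖φ‖₂²` (`ε > 0`). -/
private theorem psi_zero_window (φ : ℝ → ℂ) {ε : ℝ} (hε : 0 < ε) :
    weilConv (fun t : ℝ => (ε : ℂ)⁻¹ * φ (t / ε))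
        (weilReflect (fun t : ℝ => (ε : ℂ)⁻¹ * φ (t / ε))) 0 = ((ε⁻¹ * weilNorm2Sq φ : ℝ) : ℂ) := by
  rw [weilConv_weilReflect_apply_zero]
  congr 1
  show (∫ t : ℝ, ‖(ε : ℂ)⁻¹ * φ (t / ε)‖ ^ 2) = ε⁻¹ * weilNorm2Sq φ
  have e : (fun t : ℝ => ‖(ε : ℂ)⁻¹ * φ (t / ε)‖ ^ 2) = fun t => ε⁻¹ ^ 2 * ‖φ (t / ε)‖ ^ 2 := by
    funext t
    rw [norm_mul, norm_inv, Complex.norm_real, Real.norm_eq_abs, abs_of_pos hε, mul_pow]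
  rw [e, integral_const_mul, Measure.integral_comp_div (fun t => ‖φ t‖ ^ 2) ε, abs_of_pos hε,
    smul_eq_mul]
  unfold weilNorm2Sq
  rw [← mul_assoc, sq, mul_assoc ε⁻¹, inv_mul_cancel₀ hε.ne', mul_one]

/-! ### The Diophantine gap between logarithms of integers -/

/-- STRICT Diophantine gap: for positive integers `p < q`, `1/(p + 1) < log q − log p`
(indeed `log q − log p ≥ log((p+1)/p) = −log(1 − 1/(p+1)) > 1/(p+1)` by `x + 1 < exp x` for `x ≠ 0`). -/
private theorem log_gap_window {p q : ℕ} (hp : 1 ≤ p) (hpq : p < q) :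
    1 / ((p : ℝ) + 1) < Real.log q - Real.log p := by
  have hp0 : (0 : ℝ) < p := Nat.cast_pos.2 hp
  have hp1 : (0 : ℝ) < p + 1 := by linarith
  have hq : (p : ℝ) + 1 ≤ q := by exact_mod_cast Nat.succ_le_of_lt hpq
  have h1 : Real.log ((p : ℝ) + 1) ≤ Real.log q := Real.log_le_log hp1 hq
  -- `log (p/(p+1)) < -1/(p+1)`: from `1 - y < exp (-y)` with `y = 1/(p+1) ≠ 0`
  have hy : (-(1 / ((p : ℝ) + 1))) ≠ 0 := by
    have : (0 : ℝ) < 1 / ((p : ℝ) + 1) := by positivity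
    linarith
  have hexp := Real.add_one_lt_exp hy
  have hratio_pos : (0 : ℝ) < p / (p + 1) := div_pos hp0 hp1
  have hratio : (p : ℝ) / (p + 1) = -(1 / ((p : ℝ) + 1)) + 1 := by
    field_simp
    ring
  have h2 : Real.log ((p : ℝ) / (p + 1)) < -(1 / ((p : ℝ) + 1)) := by
    rw [Real.log_lt_iff_lt_exp hratio_pos, hratio]
    exact hexp
  rw [Real.log_div hp0.ne' hp1.ne'] at h2
  linarith

/-- For distinct positive integers `p ≠ q` with `min(p, q) ≤ M`: `1/(M + 1) < |log p − log q|`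
(strict). -/
private theorem abs_log_sub_log_window {p q M : ℕ} (hp : 1 ≤ p) (hq : 1 ≤ q) (hpq : p ≠ q)
    (hmin : p ≤ M ∨ q ≤ M) : 1 / ((M : ℝ) + 1) < |Real.log p - Real.log q| := by
  rcases lt_or_gt_of_ne hpq with h | h
  · have hpM : p ≤ M := hmin.elim id fun hqM => h.le.trans hqM
    have hpM' : (p : ℝ) + 1 ≤ (M : ℝ) + 1 := by
      have : (p : ℝ) ≤ M := by exact_mod_cast hpM
      linarith
    have hg := log_gap_window hp h
    have hpos : (0 : ℝ) < 1 / ((p : ℝ) + 1) := by positivity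
    rw [abs_sub_comm, abs_of_pos (hpos.trans hg)]
    exact (one_div_le_one_div_of_le (by positivity) hpM').trans_lt hg
  · have hqM : q ≤ M := hmin.elim (fun hpM => h.le.trans hpM) id
    have hqM' : (q : ℝ) + 1 ≤ (M : ℝ) + 1 := by
      have : (q : ℝ) ≤ M := by exact_mod_cast hqM
      linarith
    have hg := log_gap_window hq h
    have hpos : (0 : ℝ) < 1 / ((q : ℝ) + 1) := by positivity
    rw [abs_of_pos (hpos.trans hg)]
    exact (one_div_le_one_div_of_le (by positivity) hqM').trans_lt hg

/-- On the window `2ε(M+1) ≤ 1`: `ψ_ε(log p − log q) = 0` for distinct positive integers `p ≠ q`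
with `min(p, q) ≤ M` (the strict gap `|log p − log q| > 1/(M+1) ≥ 2ε` beats the support radius `2ε`
of `ψ_ε`). -/
private theorem psi_log_sub_log_eq_zero_window {φ : ℝ → ℂ} {ε : ℝ} (hφ : IsWeilTest φ)
    (hsupp : tsupport φ ⊆ Icc (-1) 1) (hε : 0 < ε) {M : ℕ} (hw : 2 * ε * ((M : ℝ) + 1) ≤ 1)
    {p q : ℕ} (hp : 1 ≤ p) (hq : 1 ≤ q) (hpq : p ≠ q) (hmin : p ≤ M ∨ q ≤ M) :
    weilConv (fun t : ℝ => (ε : ℂ)⁻¹ * φ (t / ε))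
        (weilReflect (fun t : ℝ => (ε : ℂ)⁻¹ * φ (t / ε))) (Real.log p - Real.log q) = 0 := by
  refine psi_eq_zero_window hφ hsupp hε
    (lt_of_le_of_lt ?_ (abs_log_sub_log_window hp hq hpq hmin))
  have hMpos : (0 : ℝ) < (M : ℝ) + 1 := by positivity
  rw [le_div_iff₀ hMpos]
  linarith

/-! ### Combinatorics of the comb kernel -/

/-- `[1, M/n] = {m ∈ [1, M] : n m ≤ M}` for `n ≥ 1`. -/
private theorem Icc_div_eq_filter_window {M n : ℕ} (hn : 1 ≤ n) :
    Finset.Icc 1 (M / n) = (Finset.Icc 1 M).filter (fun m => n * m ≤ M) := by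
  ext m
  simp only [Finset.mem_filter, Finset.mem_Icc]
  constructor
  · rintro ⟨h1, h2⟩
    have h3 : m * n ≤ M := (Nat.le_div_iff_mul_le hn).1 h2
    refine ⟨⟨h1, le_trans (Nat.le_mul_of_pos_right m hn) h3⟩, ?_⟩
    rwa [mul_comm] at h3
  · rintro ⟨⟨h1, -⟩, h3⟩
    exact ⟨h1, (Nat.le_div_iff_mul_le hn).2 (by rwa [mul_comm] at h3)⟩

/-- Swapping the order of summation over the pairs `n m ≤ M`, `n, m ≥ 1`. -/
private theorem sum_div_swap_window (M : ℕ) (f : ℕ → ℕ → ℂ) :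
    ∑ n ∈ Finset.Icc 1 M, ∑ m ∈ Finset.Icc 1 (M / n), f n m =
      ∑ m ∈ Finset.Icc 1 M, ∑ n ∈ Finset.Icc 1 (M / m), f n m := by
  refine Finset.sum_comm' fun n m => ?_
  simp only [Finset.mem_Icc]
  constructor
  · rintro ⟨⟨hn1, -⟩, hm1, hmM⟩
    have h : m * n ≤ M := (Nat.le_div_iff_mul_le hn1).1 hmM
    refine ⟨⟨hn1, (Nat.le_div_iff_mul_le hm1).2 (by rwa [mul_comm] at h)⟩, hm1,
      le_trans (Nat.le_mul_of_pos_right m hn1) h⟩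
  · rintro ⟨⟨hn1, hnM⟩, hm1, -⟩
    have h : n * m ≤ M := (Nat.le_div_iff_mul_le hm1).1 hnM
    refine ⟨⟨hn1, le_trans (Nat.le_mul_of_pos_right n hm1) h⟩, hm1,
      (Nat.le_div_iff_mul_le hn1).2 (by rwa [mul_comm] at h)⟩

/-- `K(log n) = ψ(0) Σ_{m' ≤ M/n} a(n m') conj a(m')` for `n ≥ 1`, whenever `ψ(log p − log q) = 0`
for all distinct positive integers `p ≠ q` with `min(p, q) ≤ M`. -/
private theorem comb_kernel_log_window {ψ : ℝ → ℂ} {M : ℕ} (a : ℕ → ℂ)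
    (hvan : ∀ p q : ℕ, 1 ≤ p → 1 ≤ q → p ≠ q → (p ≤ M ∨ q ≤ M) →
      ψ (Real.log p - Real.log q) = 0)
    {n : ℕ} (hn : 1 ≤ n) :
    ∑ m ∈ Finset.Icc 1 M, ∑ m' ∈ Finset.Icc 1 M,
        a m * conj (a m') * ψ (Real.log n - (Real.log m - Real.log m')) =
      ψ 0 * ∑ m' ∈ Finset.Icc 1 (M / n), a (n * m') * conj (a m') := by
  have hn0 : (n : ℝ) ≠ 0 := (Nat.cast_pos.2 hn).ne'
  rw [Finset.sum_comm, Finset.mul_sum, Icc_div_eq_filter_window hn, Finset.sum_filter]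
  refine Finset.sum_congr rfl fun m' hm' => ?_
  have hm'1 : 1 ≤ m' := (Finset.mem_Icc.1 hm').1
  have hm'0 : (m' : ℝ) ≠ 0 := (Nat.cast_pos.2 hm'1).ne'
  have e : ∀ m : ℕ, Real.log n - (Real.log m - Real.log m') =
      Real.log ((n * m' : ℕ) : ℝ) - Real.log m := fun m => by
    rw [Nat.cast_mul, Real.log_mul hn0 hm'0]
    ring
  split_ifs with hnm
  · rw [Finset.sum_eq_single_of_mem (n * m') (Finset.mem_Icc.2 ⟨Nat.mul_pos hn hm'1, hnm⟩) ?_]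
    · rw [e, sub_self]
      ring
    · intro m hm hne
      rw [e, hvan (n * m') m (Nat.mul_pos hn hm'1) (Finset.mem_Icc.1 hm).1 (Ne.symm hne)
        (Or.inr (Finset.mem_Icc.1 hm).2), mul_zero]
  · refine Finset.sum_eq_zero fun m hm => ?_
    have hmM : m ≤ M := (Finset.mem_Icc.1 hm).2
    have hne : n * m' ≠ m := fun h => hnm (h ▸ hmM)
    rw [e, hvan (n * m') m (Nat.mul_pos hn hm'1) (Finset.mem_Icc.1 hm).1 hne (Or.inr hmM),
      mul_zero]

/-- `K(−log n) = ψ(0) Σ_{m ≤ M/n} a(m) conj a(n m)` for `n ≥ 1`, under the same vanishing. -/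
private theorem comb_kernel_neg_log_window {ψ : ℝ → ℂ} {M : ℕ} (a : ℕ → ℂ)
    (hvan : ∀ p q : ℕ, 1 ≤ p → 1 ≤ q → p ≠ q → (p ≤ M ∨ q ≤ M) →
      ψ (Real.log p - Real.log q) = 0)
    {n : ℕ} (hn : 1 ≤ n) :
    ∑ m ∈ Finset.Icc 1 M, ∑ m' ∈ Finset.Icc 1 M,
        a m * conj (a m') * ψ (-Real.log n - (Real.log m - Real.log m')) =
      ψ 0 * ∑ m ∈ Finset.Icc 1 (M / n), a m * conj (a (n * m)) := by
  have hn0 : (n : ℝ) ≠ 0 := (Nat.cast_pos.2 hn).ne'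
  rw [Finset.mul_sum, Icc_div_eq_filter_window hn, Finset.sum_filter]
  refine Finset.sum_congr rfl fun m hm => ?_
  have hm1 : 1 ≤ m := (Finset.mem_Icc.1 hm).1
  have hm0 : (m : ℝ) ≠ 0 := (Nat.cast_pos.2 hm1).ne'
  have e : ∀ m' : ℕ, -Real.log n - (Real.log m - Real.log m') =
      Real.log m' - Real.log ((n * m : ℕ) : ℝ) := fun m' => by
    rw [Nat.cast_mul, Real.log_mul hn0 hm0]
    ring
  split_ifs with hnm
  · rw [Finset.sum_eq_single_of_mem (n * m) (Finset.mem_Icc.2 ⟨Nat.mul_pos hn hm1, hnm⟩) ?_]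
    · rw [e, sub_self]
      ring
    · intro m' hm' hne
      rw [e, hvan m' (n * m) (Finset.mem_Icc.1 hm').1 (Nat.mul_pos hn hm1) hne
        (Or.inl (Finset.mem_Icc.1 hm').2), mul_zero]
  · refine Finset.sum_eq_zero fun m' hm' => ?_
    have hm'M : m' ≤ M := (Finset.mem_Icc.1 hm').2
    have hne : m' ≠ n * m := fun h => hnm (h ▸ hm'M)
    rw [e, hvan m' (n * m) (Finset.mem_Icc.1 hm').1 (Nat.mul_pos hn hm1) hne (Or.inl hm'M),
      mul_zero]

/-- The prime term of the comb kernel `K = Σ_{m,m'} a_m conj(a_{m'}) τ_{log m − log m'} ψ` when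
`ψ(log p − log q) = 0` for all distinct positive integers `p ≠ q` with `min(p, q) ≤ M`:
a finite sum over `1 ≤ n ≤ M`. -/
private theorem weilPrimeTerm_comb_kernel_window {ψ : ℝ → ℂ} {M : ℕ} (a : ℕ → ℂ)
    (hvan : ∀ p q : ℕ, 1 ≤ p → 1 ≤ q → p ≠ q → (p ≤ M ∨ q ≤ M) →
      ψ (Real.log p - Real.log q) = 0) :
    weilPrimeTerm (fun t : ℝ => ∑ m ∈ Finset.Icc 1 M, ∑ m' ∈ Finset.Icc 1 M,
        a m * conj (a m') * weilTranslate ψ (Real.log (m : ℝ) - Real.log (m' : ℝ)) t) =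
      ψ 0 * ∑ n ∈ Finset.Icc 1 M,
        ((ArithmeticFunction.vonMangoldt n : ℝ) : ℂ) / (Real.sqrt n : ℂ) *
          ∑ m ∈ Finset.Icc 1 (M / n), (a (n * m) * conj (a m) + a m * conj (a (n * m))) := by
  unfold weilPrimeTerm
  simp only [weilTranslate]
  refine (tsum_eq_sum (s := Finset.Icc 1 M) fun n hn => ?_).trans ?_
  · rcases Nat.eq_zero_or_pos n with rfl | hpos
    · simp
    · have hMn : M < n := by
        by_contra h
        exact hn (Finset.mem_Icc.2 ⟨hpos, not_lt.1 h⟩)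
      rw [comb_kernel_log_window a hvan hpos, comb_kernel_neg_log_window a hvan hpos,
        Nat.div_eq_of_lt hMn]
      simp
  · rw [Finset.mul_sum]
    refine Finset.sum_congr rfl fun n hn => ?_
    have hn1 : 1 ≤ n := (Finset.mem_Icc.1 hn).1
    rw [comb_kernel_log_window a hvan hn1, comb_kernel_neg_log_window a hvan hn1, ← mul_add,
      ← Finset.sum_add_distrib]
    ring

/-- Final bookkeeping: with `c_n = Λ(n) n^{-1/2}` (real) and `z_{n,m} = a(nm) conj a(m)`,
`Σ_{n ≤ M} c_n Σ_{m ≤ M/n} (z_{n,m} + conj z_{n,m}) = 2 Re Σ_{m ≤ M} Σ_{n ≤ M/m} c_n z_{n,m}`. -/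
private theorem prime_sum_swap_window (M : ℕ) (a : ℕ → ℂ) :
    ∑ n ∈ Finset.Icc 1 M, ((ArithmeticFunction.vonMangoldt n : ℝ) : ℂ) / (Real.sqrt n : ℂ) *
        ∑ m ∈ Finset.Icc 1 (M / n), (a (n * m) * conj (a m) + a m * conj (a (n * m))) =
      ((2 * (∑ m ∈ Finset.Icc 1 M, ∑ n ∈ Finset.Icc 1 (M / m),
        ((ArithmeticFunction.vonMangoldt n : ℝ) : ℂ) / (Real.sqrt n : ℂ) * a (n * m) *
          conj (a m)).re : ℝ) : ℂ) := by
  have hc : ∀ n : ℕ, conj (((ArithmeticFunction.vonMangoldt n : ℝ) : ℂ) / (Real.sqrt n : ℂ)) =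
      ((ArithmeticFunction.vonMangoldt n : ℝ) : ℂ) / (Real.sqrt n : ℂ) := fun n => by
    rw [map_div₀, Complex.conj_ofReal, Complex.conj_ofReal]
  simp_rw [Finset.mul_sum]
  conv_lhs => rw [sum_div_swap_window]
  rw [← Complex.add_conj, map_sum, ← Finset.sum_add_distrib]
  refine Finset.sum_congr rfl fun m _ => ?_
  rw [map_sum, ← Finset.sum_add_distrib]
  refine Finset.sum_congr rfl fun n _ => ?_
  rw [map_mul, map_mul, hc, Complex.conj_conj]
  ring

/-- **Exact prime term on the whole exact-Helson window.**  For a Weil test `φ` supported in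
`[-1, 1]`, `0 < ε`, `M ≥ 1` and `2ε(M+1) ≤ 1`, the prime term of the comb autocorrelation `k = g ⋆ g̃`
is exactly `ε⁻¹ ‖φ‖₂² ⟨S_M a, a⟩` (the von Mangoldt Helson form):
`Σₙ Λ(n) n^{-1/2} (k(log n) + k(−log n)) = ε⁻¹ ‖φ‖₂² · 2 Re Σ_{m ≤ M} Σ_{n ≤ M/m} Λ(n) n^{-1/2} a(nm) conj a(m)`.
Sharp-window form of `WeilCombSubcritical.stub_prime` (there: `8εM ≤ 1`); the comb autocorrelation is the landed
`WeilCombSubcritical.stub_autocorrelation`. [folklore] -/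
theorem weilPrimeTerm_comb_exactWindow :
    ∀ φ : ℝ → ℂ, IsWeilTest φ → tsupport φ ⊆ Set.Icc (-1) 1 →
      ∀ ε : ℝ, 0 < ε → ∀ (M : ℕ) (a : ℕ → ℂ), 1 ≤ M → 2 * ε * ((M : ℝ) + 1) ≤ 1 →
        weilPrimeTerm
            (weilConv (fun x : ℝ => ∑ m ∈ Finset.Icc 1 M,
                a m * ((ε : ℂ)⁻¹ * φ ((x - Real.log (m : ℝ)) / ε)))
              (weilReflect (fun x : ℝ => ∑ m ∈ Finset.Icc 1 M,
                a m * ((ε : ℂ)⁻¹ * φ ((x - Real.log (m : ℝ)) / ε))))) =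
          ((ε⁻¹ * weilNorm2Sq φ *
              (2 * (∑ m ∈ Finset.Icc 1 M, ∑ n ∈ Finset.Icc 1 (M / m),
                ((ArithmeticFunction.vonMangoldt n : ℝ) : ℂ) / (Real.sqrt n : ℂ) * a (n * m) *
                  conj (a m)).re) : ℝ) : ℂ) := by
  intro φ hφ hsupp ε hε M a _hM hw
  rw [Summit.RiemannHypothesis.RiemannHypothesis.Theorems.WeilCombSubcritical.stub_autocorrelation
    φ hφ ε hε M a]
  have hvan : ∀ p q : ℕ, 1 ≤ p → 1 ≤ q → p ≠ q → (p ≤ M ∨ q ≤ M) →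
      weilConv (fun t : ℝ => (ε : ℂ)⁻¹ * φ (t / ε))
        (weilReflect (fun t : ℝ => (ε : ℂ)⁻¹ * φ (t / ε))) (Real.log p - Real.log q) = 0 :=
    fun p q hp hq hpq hmin => psi_log_sub_log_eq_zero_window hφ hsupp hε hw hp hq hpq hmin
  rw [weilPrimeTerm_comb_kernel_window a hvan, psi_zero_window φ hε, prime_sum_swap_window M a,
    ← Complex.ofReal_mul]

/-- **Exact three-term identity on the window (the fixed-shape comb of the crux).**  For `0 < ε`, `M ≥ 1`,
`2ε(M+1) ≤ 1` and the fixed bump `φ₀ = expNegInvGlue (1 - u²)`: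
`Re Q(g) = Re P(k) − ε⁻¹ ‖φ₀‖₂² ⟨S_M a, a⟩ + Re W_∞(k)`, `k = g ⋆ g̃` (`Q = W = P − Pr + A` by definition,
prime term exact by `weilPrimeTerm_comb_exactWindow`, `φ₀` admissible by `combShapeAdmissible_proof`'s
components re-proved inline).  This is the "ExactWindowIdentity" bookkeeping from which any proof of
Theorem B (`2ε(M+1) ≤ 1 ⇒ 0 ≤ Re Q`) starts: polar and archimedean parts kept whole and signed. [folklore] -/
theorem weilQuadratic_comb_re_exactWindow : ∀ ε : ℝ, 0 < ε → ∀ (M : ℕ) (a : ℕ → ℂ), 1 ≤ M →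
    2 * ε * ((M : ℝ) + 1) ≤ 1 →
    (weilQuadratic (fun x : ℝ => ∑ m ∈ Finset.Icc 1 M,
        a m * ((ε : ℂ)⁻¹ * ((expNegInvGlue (1 - ((x - Real.log (m : ℝ)) / ε) ^ 2) : ℝ) : ℂ)))).re =
      (weilPolarTerm
          (weilConv (fun x : ℝ => ∑ m ∈ Finset.Icc 1 M,
              a m * ((ε : ℂ)⁻¹ * ((expNegInvGlue (1 - ((x - Real.log (m : ℝ)) / ε) ^ 2) : ℝ) : ℂ)))
            (weilReflect (fun x : ℝ => ∑ m ∈ Finset.Icc 1 M,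
              a m * ((ε : ℂ)⁻¹ * ((expNegInvGlue (1 - ((x - Real.log (m : ℝ)) / ε) ^ 2) : ℝ) : ℂ)))))).re
        - ε⁻¹ * weilNorm2Sq (fun u : ℝ => ((expNegInvGlue (1 - u ^ 2) : ℝ) : ℂ)) *
            (2 * (∑ m ∈ Finset.Icc 1 M, ∑ n ∈ Finset.Icc 1 (M / m),
              ((ArithmeticFunction.vonMangoldt n : ℝ) : ℂ) / (Real.sqrt n : ℂ) * a (n * m) *
                conj (a m)).re)
        + (weilArchTerm
          (weilConv (fun x : ℝ => ∑ m ∈ Finset.Icc 1 M,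
              a m * ((ε : ℂ)⁻¹ * ((expNegInvGlue (1 - ((x - Real.log (m : ℝ)) / ε) ^ 2) : ℝ) : ℂ)))
            (weilReflect (fun x : ℝ => ∑ m ∈ Finset.Icc 1 M,
              a m * ((ε : ℂ)⁻¹ * ((expNegInvGlue (1 - ((x - Real.log (m : ℝ)) / ε) ^ 2) : ℝ) : ℂ)))))).re := by
  intro ε hε M a hM hw
  -- the fixed bump is a Weil test supported in `[-1, 1]`
  have hφsupp : Function.support (fun u : ℝ => ((expNegInvGlue (1 - u ^ 2) : ℝ) : ℂ)) ⊆ Set.Icc (-1) 1 := by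
    intro u hu
    by_contra h
    apply hu
    have h1 : 1 - u ^ 2 ≤ 0 := by
      simp only [Set.mem_Icc, not_and_or, not_le] at h
      rcases h with h | h <;> nlinarith
    simp [expNegInvGlue.zero_of_nonpos h1]
  have hφ : IsWeilTest (fun u : ℝ => ((expNegInvGlue (1 - u ^ 2) : ℝ) : ℂ)) :=
    ⟨Complex.ofRealCLM.contDiff.comp
        (expNegInvGlue.contDiff.comp (contDiff_const.sub (contDiff_id.pow 2))),
      HasCompactSupport.of_support_subset_isCompact isCompact_Icc hφsupp⟩
  have hsupp : tsupport (fun u : ℝ => ((expNegInvGlue (1 - u ^ 2) : ℝ) : ℂ)) ⊆ Set.Icc (-1) 1 :=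
    closure_minimal hφsupp isClosed_Icc
  have hP := weilPrimeTerm_comb_exactWindow (fun u : ℝ => ((expNegInvGlue (1 - u ^ 2) : ℝ) : ℂ))
    hφ hsupp ε hε M a hM hw
  beta_reduce at hP
  simp only [weilQuadratic, weilFunctional, Complex.add_re, Complex.sub_re]
  rw [hP, Complex.ofReal_re]

end Summit.RiemannHypothesis.RiemannHypothesis.Theorems.WeilCombBohrFejer

end
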